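import Summits.QuantumFields.BalabanUV.T4Continuum.Support.NE7OneStepOfCritical
import Summits.QuantumFields.BalabanUV.T4Continuum.Support.NE7SegmentPlaquetteRadius
import Summits.QuantumFields.BalabanUV.T4Continuum.Support.NE7OneStepLetters
import HarnessLib

/-!
# NE7ConvOneStepEnd — CONV-ONE-STEP ASSEMBLED: a small-field admissible configuration that is CRITICAL ON A POINCARÉ SLICE is a GLOBAL constrained
# minimiser as soon as every competitor is REPRESENTED over it by a direction with a tangent∕normal split carrying two quadratic normal letters —
# and hence ONE-STEP ∕ (8)∃ from «CRIT-ONE-STEP + representation» (files F1–F3 of this generation composed; one numeric line, k-uniform in shape)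

Cell `pub-balaban`, rung (B)+1 sub-cell t4, lineage `b2b-balaban-t4-ne7-p1`, generation 66 (CRUX PROVER NE7 #1); hunt (h10) «ONE-STEP = CRIT ∧ CONV»,
memo `t4/b2b-balaban-t4-ne7-p1-g66/HUNT-H10-TWO-ROADS.md` §2.  File F4 = F1 `NE7OneStepOfCritical` (p347261) ∘ F2 `NE7SegmentPlaquetteRadius`
(p346812) ∘ F3 `NE7OneStepLetters` (p347821).

THE STATEMENT (**`isMinimiser_of_critical_rep`**, any class family `𝒞`, level `k`, `L, N ≥ 1`).  Let `U♯ ∈ admissible 𝒞 L k V` be unitary with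
`SmallField U♯ a` (`a ≥ 0`), let `T` be a set of directions on which (P♮) holds at `U♯` with constant `C > 0` on the period box
(`NE3SlicePoincareShape.SlicePoincare L k U♯ T C (periodBox (N·L^k))` — row NE3's shape; its class-level k-uniform instance on the block-Landau
tangent slice is `NE3ClassSlicePoincare.classSlicePoincare_of_lines`) and on which `U♯` is CRITICAL (`dAction U♯ Y (perWin) = 0` for `Y ∈ T` — for an
interior constrained minimiser the tree's `NE7MinimiserTensionPairing.critical_of_interior_isMinimiser`; here a HYPOTHESIS on `U♯`).  Suppose every
admissible `U′` is REPRESENTED over `U♯`: a skew `(N·L^k)`-periodic `X` with `‖X(b)‖ ≤ α`, `levelAction (U♯e^{X}) ≤ levelAction U′` (gauge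
representative), `SmallField (U♯e^{X}) a`, and a split `X = X_T + X_N`, `X_T ∈ T`, `X_N` skew periodic with the two NORMAL LETTERS
`dirSq X_N ≤ θ·dirSq X` and `Σ_{perWin}‖(d_{U♯}X_N)(p)‖ ≤ C_N·dirSq X` ([Balaban1985Variational] Prop. 2 TYPE + the second-order remainder of the
average — HYPOTHESES), under the ONE numeric line
  `2·a·C_N ≤ (m∕2 − 576d(e^{α} − 1)²)∕card n − 28d·(a + 7α²)`,  `m = (L^k)^{−2}∕(4C) − ((L^k)^{−2}∕(2C) + 16d)·θ`.
THEN `IsMinimiser d 𝒞 L N k V U♯` — `U♯` is a GLOBAL minimiser of the level action over the closed admissible set.  Reading of the line at the natural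
scales (memo H10 §2 (d)): with `a = ε(L^k)^{−2}` and `α = c_α·ε·L^{−k}`, multiplying the line by `(L^k)²` it reads
`2ε·C_N(L^k)² ≤ 1∕(32C·card n) − (16d·θ(L^k)²)∕(…) − O(ε²) − 28d(ε + 7c_α²ε²)`, so the suppliers must deliver `C_N(L^k)² = O(ε)` and
`θ(L^k)² = o(1∕(C·d))` — the normal part small AT THE SCALE OF THE CURVATURE, which is what a representative with `‖X‖_∞ = O(εL^{−k})` and
`‖X_N‖ = O(‖X‖_∞·‖X‖)` gives.  Nothing of this arithmetic is a theorem here; the line is DISPLAYED.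
§2 **`oneStep_of_critical_rep`** ∕ **`hint_of_critical_rep`** — the ONE-STEP binder of `NE7InteriorInduction.interior_exists_all_levels` and (8)∃
(`hint_of_oneStep`) from «for every admissible competitor `U₀` of level `k+1` with `SmallField U₀ (δ(L^k)^{−2})` there is an admissible `U♯` with
`SmallField U♯ (δ(L^{k+1})^{−2})`, a Poincaré slice on which it is critical, and the representation of every admissible `U′` with the line» —
CRIT-ONE-STEP + REP, the honest residual of ONE-STEP after this generation (memo H10 §1: CRIT-ONE-STEP = [Balaban1985Variational] Thm 1's printed
content under the LOCAL reading, Sects. B–E, p. 300 «we will use only the fact that they are critical configurations of the functional (5)»; REP =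
Prop. 2 TYPE; (P♮) = row NE3, in tree at class level).
HONEST FRAMING (page 1): [folklore] composition over HYPOTHESES; nothing is asserted about Bałaban's minimisers; 0 def, 0 sorry; NOT ONE-STEP, NOT NE7;
spine 0∕9; finite T⁴ rung (B)+1 — NOT infinite volume, NOT mass gap, NOT Clay.  Continuum YM on T⁴ ⇐ BetaPertH ∧ nine spine estimates (0/9 proved);
BetaPertH ⇐ (D1) ∧ (D4) ∧ CAP+tail; G-an2-4 gates asym, D1 and NE2/3/4.
-/

set_option autoImplicit false

open scoped BigOperators Matrix.Norms.L2Operator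
open NormedSpace Finset Set

namespace Summit.QuantumFields.BalabanUV.T4Continuum.NE7ConvOneStepEnd

open Literature.MathematicalPhysics.QuantumFieldTheory.Balaban1983to89
open B7Prop1Explicit B7Prop2Explicit MatrixLog UnitaryModel
open T4AveragingDeficitWall (IsUnitaryCfg IsSkewDir SmallField fineAction vary curl curlSq dirSq)
open T4AveragingDeficitWallBoundary (IsPeriodicCfg periodBox)
open AveragingDeficitPeriodicCounting (IsPeriodicDir)
open MinimalActionLevels (levelAction perWin)
open MinimalActionSandwich (IsMinimiser admissible)
open MinimalActionRate (sfClass)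
open NE3HessForm (dAction)
open NE3SlicePoincareShape (SlicePoincare)
open NE7InteriorInduction (interior_exists_all_levels hint_of_oneStep)
open NE7OneStepOfCritical (isMinimiser_of_poincare_slop)
open NE7SegmentPlaquetteRadius (smallField_vary_segment_class)
open NE7OneStepLetters (slop_of_tangent_critical curlSq_ge_of_slicePoincare)

noncomputable section

variable {d : ℕ} {n : Type*} [Fintype n] [DecidableEq n]

/-! ## §1 CONV-ONE-STEP at a fixed level -/

/-- **CONV-ONE-STEP, ASSEMBLED.**  See the module docstring: criticality of `U♯` on a Poincaré slice `T` + representation of every competitor with a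
tangent∕normal split and the two normal letters + one numeric line ⟹ `U♯` is a GLOBAL constrained minimiser (`IsMinimiser`). [folklore] -/
theorem isMinimiser_of_critical_rep [Nonempty n] {𝒞 : ℕ → Set (Site d → Fin d → (Matrix n n ℂ)ˣ)} {L N k : ℕ} (hL : 1 ≤ L) (hN : 1 ≤ N)
    {V Us : Site d → Fin d → (Matrix n n ℂ)ˣ} (hmem : Us ∈ admissible 𝒞 L k V) (hUs : IsUnitaryCfg Us) {a : ℝ} (ha : 0 ≤ a)
    (hUsa : SmallField Us a) {T : Set (Site d → Fin d → Matrix n n ℂ)} {C : ℝ} (hC : 0 < C)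
    (hP : SlicePoincare L k Us T C (periodBox (d := d) (N * L ^ k)))
    (hcrit : ∀ Y ∈ T, dAction Us Y (perWin d (N * L ^ k)) = 0)
    (hrep : ∀ U' ∈ admissible 𝒞 L k V, ∃ (X XT XN : Site d → Fin d → Matrix n n ℂ) (α θ CN : ℝ),
      IsSkewDir X ∧ IsPeriodicDir X ((N * L ^ k : ℕ) : ℤ) ∧ 0 ≤ α ∧ (∀ x μ, ‖X x μ‖ ≤ α) ∧
      levelAction d L N k (vary Us X 1) ≤ levelAction d L N k U' ∧ SmallField (vary Us X 1) a ∧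
      X = XT + XN ∧ XT ∈ T ∧ IsSkewDir XN ∧ IsPeriodicDir XN ((N * L ^ k : ℕ) : ℤ) ∧
      dirSq XN (periodBox (d := d) (N * L ^ k)) ≤ θ * dirSq X (periodBox (d := d) (N * L ^ k)) ∧
      (∑ p ∈ perWin d (N * L ^ k), ‖curl Us XN p‖) ≤ CN * dirSq X (periodBox (d := d) (N * L ^ k)) ∧
      2 * (a * CN) ≤ (((((((L : ℝ) ^ k)⁻¹) ^ 2 / C) / 4 - (((((L : ℝ) ^ k)⁻¹) ^ 2 / C) / 2 + 16 * d) * θ) / 2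
          - 576 * d * (Real.exp α - 1) ^ 2) / (Fintype.card n : ℝ) - 28 * d * (a + 7 * α ^ 2))) :
    IsMinimiser d 𝒞 L N k V Us := by
  have hN0 : 0 < N := hN
  have hL0 : 0 < L := hL
  have hM : 0 < N * L ^ k := Nat.mul_pos hN0 (Nat.pow_pos hL0)
  refine isMinimiser_of_poincare_slop hL hN hmem hUs fun U' hU' => ?_
  obtain ⟨X, XT, XN, α, θ, CN, hXs, hXP, hα, hXα, hle, h1, hsplit, hXT, hXNs, hXNP, hN2, hN1, hline⟩ := hrep U' hU'
  refine ⟨X, α, ((((L : ℝ) ^ k)⁻¹) ^ 2 / C) / 4 - (((((L : ℝ) ^ k)⁻¹) ^ 2 / C) / 2 + 16 * d) * θ, a + 7 * α ^ 2, a * CN,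
    hXs, hXP, hα, hXα, hle, ?_, by positivity, fun t ht => ?_, ?_, hline⟩
  · exact curlSq_ge_of_slicePoincare hM hUs hC hP hsplit hXT hXNP hN2
  · exact smallField_vary_segment_class hUs hXs hUsa h1 hXα ht
  · exact slop_of_tangent_critical hUs ha hUsa hsplit hXNs (perWin d (N * L ^ k)) (periodBox (d := d) (N * L ^ k)) (hcrit XT hXT) hN1

/-! ## §2 ONE-STEP and (8)∃ from CRIT-ONE-STEP + REPRESENTATION -/

/-- **THE ONE-STEP BINDER FROM «CRIT-ONE-STEP + REP»** (class family `sfClass d L N ε`, `L, N ≥ 1`, `ε ≥ 0`): if for every level `k` and every admissible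
competitor `U₀` of level `k+1` with `SmallField U₀ (δ(L^k)^{−2})` there is an ADMISSIBLE `U♯` with `SmallField U♯ (δ(L^{k+1})^{−2})`, a direction set `T`
with (P♮) constant `C > 0` at `U♯` on which `U♯` is critical, and the representation of every admissible `U′` of level `k+1` over `U♯` (§1's package at
the class radius `a = ε(L^{k+1})^{−2}`), then ONE-STEP holds. [folklore] -/
theorem oneStep_of_critical_rep [Nonempty n] {L N : ℕ} (hL : 1 ≤ L) (hN : 1 ≤ N) {ε δ : ℝ} (hε : 0 ≤ ε)
    {V : Site d → Fin d → (Matrix n n ℂ)ˣ}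
    (hcrit : ∀ (k : ℕ) (U₀ : Site d → Fin d → (Matrix n n ℂ)ˣ), U₀ ∈ admissible (sfClass d L N ε) L (k + 1) V →
      SmallField U₀ (δ / ((L : ℝ) ^ k) ^ 2) →
      ∃ (Us : Site d → Fin d → (Matrix n n ℂ)ˣ) (T : Set (Site d → Fin d → Matrix n n ℂ)) (C : ℝ),
        Us ∈ admissible (sfClass d L N ε) L (k + 1) V ∧ SmallField Us (δ / ((L : ℝ) ^ (k + 1)) ^ 2) ∧ 0 < C ∧
        SlicePoincare L (k + 1) Us T C (periodBox (d := d) (N * L ^ (k + 1))) ∧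
        (∀ Y ∈ T, dAction Us Y (perWin d (N * L ^ (k + 1))) = 0) ∧
        ∀ U' ∈ admissible (sfClass d L N ε) L (k + 1) V, ∃ (X XT XN : Site d → Fin d → Matrix n n ℂ) (α θ CN : ℝ),
          IsSkewDir X ∧ IsPeriodicDir X ((N * L ^ (k + 1) : ℕ) : ℤ) ∧ 0 ≤ α ∧ (∀ x μ, ‖X x μ‖ ≤ α) ∧
          levelAction d L N (k + 1) (vary Us X 1) ≤ levelAction d L N (k + 1) U' ∧
          SmallField (vary Us X 1) (ε / ((L : ℝ) ^ (k + 1)) ^ 2) ∧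
          X = XT + XN ∧ XT ∈ T ∧ IsSkewDir XN ∧ IsPeriodicDir XN ((N * L ^ (k + 1) : ℕ) : ℤ) ∧
          dirSq XN (periodBox (d := d) (N * L ^ (k + 1))) ≤ θ * dirSq X (periodBox (d := d) (N * L ^ (k + 1))) ∧
          (∑ p ∈ perWin d (N * L ^ (k + 1)), ‖curl Us XN p‖) ≤ CN * dirSq X (periodBox (d := d) (N * L ^ (k + 1))) ∧
          2 * (ε / ((L : ℝ) ^ (k + 1)) ^ 2 * CN)
            ≤ (((((((L : ℝ) ^ (k + 1))⁻¹) ^ 2 / C) / 4 - (((((L : ℝ) ^ (k + 1))⁻¹) ^ 2 / C) / 2 + 16 * d) * θ) / 2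
                - 576 * d * (Real.exp α - 1) ^ 2) / (Fintype.card n : ℝ) - 28 * d * (ε / ((L : ℝ) ^ (k + 1)) ^ 2 + 7 * α ^ 2))) :
    ∀ (k : ℕ) (U₀ : Site d → Fin d → (Matrix n n ℂ)ˣ), U₀ ∈ admissible (sfClass d L N ε) L (k + 1) V →
      SmallField U₀ (δ / ((L : ℝ) ^ k) ^ 2) →
      ∃ U, IsMinimiser d (sfClass d L N ε) L N (k + 1) V U ∧ SmallField U (δ / ((L : ℝ) ^ (k + 1)) ^ 2) := by
  intro k U₀ hU₀ hU₀a
  obtain ⟨Us, T, C, hmem, hUsδ, hC, hP, hcr, hrep⟩ := hcrit k U₀ hU₀ hU₀a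
  have ha : 0 ≤ ε / ((L : ℝ) ^ (k + 1)) ^ 2 := by positivity
  exact ⟨Us, isMinimiser_of_critical_rep hL hN hmem hmem.1.1 ha hmem.1.2.2 hC hP hcr hrep, hUsδ⟩

/-- **(8)∃ FROM «CRIT-ONE-STEP + REP»** at every level over `dom = {unitary, N-periodic, SmallField · δ_V}` (`0 ≤ δ_V ≤ δ < ε`, `δ·L² ≤ ε`, `L, N ≥ 1`):
gen 64's `hint_of_oneStep` BY NAME on §2's binder. [folklore] -/
theorem hint_of_critical_rep [Nonempty n] {L N : ℕ} (hL : 1 ≤ L) (hN : 1 ≤ N) {ε δ δV : ℝ} (hδV : 0 ≤ δV) (hδVδ : δV ≤ δ) (hδε : δ < ε)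
    (hδL : δ * (L : ℝ) ^ 2 ≤ ε)
    (hcrit : ∀ V : Site d → Fin d → (Matrix n n ℂ)ˣ, IsUnitaryCfg V → IsPeriodicCfg V (N : ℤ) → SmallField V δV →
      ∀ (k : ℕ) (U₀ : Site d → Fin d → (Matrix n n ℂ)ˣ), U₀ ∈ admissible (sfClass d L N ε) L (k + 1) V →
      SmallField U₀ (δ / ((L : ℝ) ^ k) ^ 2) →
      ∃ (Us : Site d → Fin d → (Matrix n n ℂ)ˣ) (T : Set (Site d → Fin d → Matrix n n ℂ)) (C : ℝ),
        Us ∈ admissible (sfClass d L N ε) L (k + 1) V ∧ SmallField Us (δ / ((L : ℝ) ^ (k + 1)) ^ 2) ∧ 0 < C ∧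
        SlicePoincare L (k + 1) Us T C (periodBox (d := d) (N * L ^ (k + 1))) ∧
        (∀ Y ∈ T, dAction Us Y (perWin d (N * L ^ (k + 1))) = 0) ∧
        ∀ U' ∈ admissible (sfClass d L N ε) L (k + 1) V, ∃ (X XT XN : Site d → Fin d → Matrix n n ℂ) (α θ CN : ℝ),
          IsSkewDir X ∧ IsPeriodicDir X ((N * L ^ (k + 1) : ℕ) : ℤ) ∧ 0 ≤ α ∧ (∀ x μ, ‖X x μ‖ ≤ α) ∧
          levelAction d L N (k + 1) (vary Us X 1) ≤ levelAction d L N (k + 1) U' ∧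
          SmallField (vary Us X 1) (ε / ((L : ℝ) ^ (k + 1)) ^ 2) ∧
          X = XT + XN ∧ XT ∈ T ∧ IsSkewDir XN ∧ IsPeriodicDir XN ((N * L ^ (k + 1) : ℕ) : ℤ) ∧
          dirSq XN (periodBox (d := d) (N * L ^ (k + 1))) ≤ θ * dirSq X (periodBox (d := d) (N * L ^ (k + 1))) ∧
          (∑ p ∈ perWin d (N * L ^ (k + 1)), ‖curl Us XN p‖) ≤ CN * dirSq X (periodBox (d := d) (N * L ^ (k + 1))) ∧
          2 * (ε / ((L : ℝ) ^ (k + 1)) ^ 2 * CN)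
            ≤ (((((((L : ℝ) ^ (k + 1))⁻¹) ^ 2 / C) / 4 - (((((L : ℝ) ^ (k + 1))⁻¹) ^ 2 / C) / 2 + 16 * d) * θ) / 2
                - 576 * d * (Real.exp α - 1) ^ 2) / (Fintype.card n : ℝ) - 28 * d * (ε / ((L : ℝ) ^ (k + 1)) ^ 2 + 7 * α ^ 2))) :
    ∀ V ∈ {V : Site d → Fin d → (Matrix n n ℂ)ˣ | IsUnitaryCfg V ∧ IsPeriodicCfg V (N : ℤ) ∧ SmallField V δV}, ∀ k : ℕ,
      ∃ U : Site d → Fin d → (Matrix n n ℂ)ˣ, IsMinimiser d (sfClass d L N ε) L N k V U ∧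
        ∃ a : ℝ, 0 ≤ a ∧ a < ε / ((L : ℝ) ^ k) ^ 2 ∧ SmallField U a := by
  have hε : 0 ≤ ε := (hδV.trans hδVδ).trans hδε.le
  exact hint_of_oneStep hL hδV hδVδ hδε hδL fun V hVu hVp hVδ => oneStep_of_critical_rep hL hN hε (hcrit V hVu hVp hVδ)

end

end Summit.QuantumFields.BalabanUV.T4Continuum.NE7ConvOneStepEnd
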